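import Summits.QuantumFields.YangMills.Theorems.BalabanUVNodesN15KingModelMasslessOSReflectionPositivity
import Summits.QuantumFields.YangMills.Theorems.BalabanUVNodesN15KingModelOSGapLowerBound
import Summits.QuantumFields.YangMills.Theorems.BalabanUVNodesN15KingModelMasslessWeakLimit
import Summits.QuantumFields.YangMills.Theorems.BalabanUVNodesN15KingModelMasslessFieldScaling
import Mathlib.Analysis.SpecificLimits.Normed

/-!
# BalabanUVNodes ∕ N15 — THE KING-MODEL RUNG (PART Ͳ-f₃): THE ONE-POINT EXPONENTIAL OF THE MASSLESS FIELD DOES NOT CLUSTER EXPONENTIALLY —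
# its truncated Osterwalder–Schrader pairing is `e^{−S₂^{0}(0)}(e^{S₂^{0}((t+1)e₀)} − 1) ≥ e^{−S₂^{0}(0)}S₂^{0}((t+1)e₀) ≥ c∕(t + d + 2)^{d−1}`, which beats every geometric sequence `r^t`, `r < 1`
# (Track A, DAG node N15 = NE2; FAN-OUT v1.1 §N15 s3 «KING-MODEL RUNG»; count-neutral)

HONEST FRAMING.  Count-neutral (cell `pub-ymgap`, seat `pub-ymgap-dag-n15-e` g36; `--supports stmt-QuantumFields-27366 --as helper` = K3⁸).  King's `A = 0`, `g = 0` model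
([King1986] C. King, Commun. Math. Phys. **102** (1986) 649–677): the MASSLESS infinite-volume block field `μ⁰_∞` (`d + 1 ≥ 3`).  Farm-checkable half of «the transfer operator of the critical block field is
GAPLESS» (part Ͳ-f₄): for `F(φ) = e^{iφ(0)}` (a bounded positive-time observable) the OS pairing against the shifted copy is explicit (one combined Gaussian field sum, part Ϻ-ff's massless
characteristic functional): ★★ `∫ conj F(φ∘θ)·F(S^tφ) dμ⁰_∞ − (∫ conj F(φ∘θ))(∫F) = e^{−S₂^{0}(0)}(e^{S₂^{0}(e₀ + te₀)} − 1)`, a positive real `≥ e^{−S₂^{0}(0)}S₂^{0}(e₀ + te₀)`; by part Ϻ-z's canonical power law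
`S₂^{0}(z) ≥ Γ((d−1)∕2)∕(4π^{(d+1)∕2}R₊(z)^{d−1})` with `R₊(e₀ + te₀) ≤ t + d + 2`, ★★ this lower bound is `≥ c∕(t+d+2)^{d−1}` and hence ★★★ EXCEEDS `r^t` FOR SOME `t`, for every `0 ≤ r < 1`
(`t^k r^t → 0`).  NOT Bałaban's objects; NOT a node discharge; nothing continuum ∕ `ℝ⁴` ∕ Clay.  0 `sorry`, 0 def; standard axioms.

WHAT THIS FILE PROVES (kernel).  ★ `integral_conj_cexp_mul_cexp_siteMaps0`, `isBoundedMeasurable_onePoint`, ★★ `os_truncated_onePoint0_eq`, `os_truncated_onePoint0_norm_ge`, `integral_normSq_onePoint_cexp`,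
`euclidNorm_single_add_smul`, `blockSpan_axis_le`, ★★ `kingS2Inf0_axis_ge`, ★★★ **`exists_pow_lt_onePoint0_lowerBound`**.

HONEST SCOPE.  King's free massless infinite-volume block field, `d + 1 ≥ 3`.  N15 untouched; counts unmoved.
Locators (use): [King1986] Thm 2.1 (2.22) p.654, (4.5) p.670; Glimm–Jaffe 1987 §6.1, §19.7.
-/

noncomputable section

open scoped BigOperators Topology ComplexConjugate
open Filter MeasureTheory ProbabilityTheory Finset Complex

namespace Summit.QuantumFields.YangMills.BalabanUVNodes.N15KingModelRung.InfiniteVolume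

open Literature.MathematicalPhysics.QuantumFieldTheory (latticeTimeReflection latticeTimeReflection_apply positiveTimeSites positiveTimeEvents latticeTimeShift
  latticeTimeShift_apply)
open Literature.Probability.LatticeModels (configReflect configReflect_apply positiveEvents IsBoundedMeasurable)
open Summit.QuantumFields.YangMills.BalabanUVNodes.N15KingModelRung.OptimalDecay
open Summit.QuantumFields.YangMills.BalabanUVNodes.N15KingModelRung.ProperTime

variable {d : ℕ}

/-! ## §1 The cross term for two site maps, massless -/

/-- ★ Massless analogue of part Ͳ-d₁'s two-site-map cross term: `∫ conj(e^{iΣ g(z)φ(αz)})·e^{iΣ h(z)φ(βz)} dμ⁰_∞ = e^{−V_α(g)∕2}e^{−V_β(h)∕2}e^{M}` with `S₂^{0}` in place of `S₂^{ℝ}`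
(`d + 1 ≥ 3`). [cite: King1986, Thm 2.1 (2.22) p.654; GlimmJaffe1987, §6.2 Thm. 6.2.2] -/
theorem integral_conj_cexp_mul_cexp_siteMaps0 (hd : 2 ≤ d) (s : Finset (Fin (d + 1) → ℤ)) (g h : (Fin (d + 1) → ℤ) → ℝ)
    (α β : (Fin (d + 1) → ℤ) → (Fin (d + 1) → ℤ)) :
    ∫ ω, conj (Complex.exp (((∑ z ∈ s, g z * ω (α z) : ℝ) : ℂ) * I)) * Complex.exp (((∑ z ∈ s, h z * ω (β z) : ℝ) : ℂ) * I) ∂kingFieldInf0 d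
      = ((Real.exp (-((∑ z ∈ s, ∑ w ∈ s, g z * g w * kingS2Inf0 (α w - α z)) / 2)) : ℝ) : ℂ)
        * ((Real.exp (-((∑ z ∈ s, ∑ w ∈ s, h z * h w * kingS2Inf0 (β w - β z)) / 2)) : ℝ) : ℂ)
        * ((Real.exp (∑ z ∈ s, ∑ w ∈ s, g z * h w * kingS2Inf0 (β w - α z)) : ℝ) : ℂ) := by
  haveI := isProbabilityMeasure_kingFieldInf0 hd
  set Vg : ℝ := ∑ z ∈ s, ∑ w ∈ s, g z * g w * kingS2Inf0 (α w - α z) with hVg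
  set Vh : ℝ := ∑ z ∈ s, ∑ w ∈ s, h z * h w * kingS2Inf0 (β w - β z) with hVh
  set M : ℝ := ∑ z ∈ s, ∑ w ∈ s, g z * h w * kingS2Inf0 (β w - α z) with hM
  set p : Bool × (Fin (d + 1) → ℤ) → (Fin (d + 1) → ℤ) := fun q => if q.1 then α q.2 else β q.2 with hp
  set c : Bool × (Fin (d + 1) → ℤ) → ℝ := fun q => if q.1 then -g q.2 else h q.2 with hc
  have hsplit : ∀ ω : (Fin (d + 1) → ℤ) → ℝ, ∑ q ∈ Finset.univ ×ˢ s, c q * ω (p q) = -(∑ z ∈ s, g z * ω (α z)) + ∑ z ∈ s, h z * ω (β z) := by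
    intro ω
    rw [Finset.sum_product, Fintype.sum_bool]
    simp [hp, hc, Finset.sum_neg_distrib]
  have hfun : (fun ω : (Fin (d + 1) → ℤ) → ℝ => conj (Complex.exp (((∑ z ∈ s, g z * ω (α z) : ℝ) : ℂ) * I)) * Complex.exp (((∑ z ∈ s, h z * ω (β z) : ℝ) : ℂ) * I))
      = fun ω => Complex.exp (((∑ q ∈ Finset.univ ×ˢ s, c q * ω (p q) : ℝ) : ℂ) * I) := by
    funext ω
    rw [← Complex.exp_conj, map_mul, Complex.conj_ofReal, Complex.conj_I, ← Complex.exp_add, hsplit]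
    push_cast
    ring_nf
  have hvar : ∑ q ∈ Finset.univ ×ˢ s, ∑ q' ∈ Finset.univ ×ˢ s, c q * c q' * kingS2Inf0 (p q' - p q) = Vg + Vh - 2 * M := by
    rw [Finset.sum_product, Fintype.sum_bool]
    simp only [Finset.sum_product, Fintype.sum_bool, hp, hc, if_true, Bool.false_eq_true, if_false, Finset.sum_add_distrib]
    have hAA : ∑ z ∈ s, ∑ w ∈ s, -g z * -g w * kingS2Inf0 (α w - α z) = Vg := by
      refine Finset.sum_congr rfl fun z _ => Finset.sum_congr rfl fun w _ => ?_; ring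
    have hAB : ∑ z ∈ s, ∑ w ∈ s, -g z * h w * kingS2Inf0 (β w - α z) = -M := by
      rw [hM]
      simp only [← Finset.sum_neg_distrib]
      refine Finset.sum_congr rfl fun z _ => Finset.sum_congr rfl fun w _ => ?_; ring
    have hBA : ∑ z ∈ s, ∑ w ∈ s, h z * -g w * kingS2Inf0 (α w - β z) = -M := by
      rw [hM]
      simp only [← Finset.sum_neg_distrib]
      rw [Finset.sum_comm]
      refine Finset.sum_congr rfl fun z _ => Finset.sum_congr rfl fun w _ => ?_
      rw [← kingS2Inf0_neg (α z - β w), neg_sub]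
      ring
    rw [hAA, hAB, hBA]
    ring
  rw [hfun, integral_cexp_I_fieldSum0 hd, hvar, ← Complex.ofReal_mul, ← Complex.ofReal_mul, ← Real.exp_add, ← Real.exp_add, Complex.ofReal_exp]
  congr 1
  push_cast
  ring

/-! ## §2 The one-point exponential observable -/

/-- `e^{iφ(0)}` is a bounded positive-time observable. [cite: GlimmJaffe1987, §6.1 (𝓔₊)] -/
theorem isBoundedMeasurable_onePoint :
    IsBoundedMeasurable (positiveTimeEvents (d + 1) ℝ) fun ω : (Fin (d + 1) → ℤ) → ℝ => Complex.exp (((ω 0 : ℝ) : ℂ) * I) := by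
  refine ⟨?_, 1, fun ω => by rw [Complex.norm_exp_ofReal_mul_I]⟩
  have h0 : (0 : Fin (d + 1) → ℤ) ∈ positiveTimeSites (d + 1) := by
    show (0 : ℤ) ≤ (0 : Fin (d + 1) → ℤ) 0
    simp
  exact Complex.measurable_exp.comp ((Complex.measurable_ofReal.comp (measurable_cylinderEvent_apply (X := fun _ : Fin (d + 1) → ℤ => ℝ) h0)).mul_const I)

/-- The three Gaussian integrals of the one-point exponential under `μ⁰_∞`. [cite: King1986, Thm 2.1 (2.22) p.654] -/
theorem os_pairing_onePoint0_data (hd : 2 ≤ d) (t : ℕ) :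
    (∫ ω, conj ((fun ω : (Fin (d + 1) → ℤ) → ℝ => Complex.exp (((ω 0 : ℝ) : ℂ) * I)) (configReflect (latticeTimeReflection (d + 1)) ω))
        * (fun ω : (Fin (d + 1) → ℤ) → ℝ => Complex.exp (((ω 0 : ℝ) : ℂ) * I)) ((latticeTimeShift (d + 1) ℝ)^[t] ω) ∂kingFieldInf0 d
        = ((Real.exp (-(kingS2Inf0 (0 : Fin (d + 1) → ℤ) / 2)) : ℝ) : ℂ) * ((Real.exp (-(kingS2Inf0 (0 : Fin (d + 1) → ℤ) / 2)) : ℝ) : ℂ)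
            * ((Real.exp (kingS2Inf0 ((Pi.single 0 1 : Fin (d + 1) → ℤ) + (t : ℤ) • (Pi.single 0 (1 : ℤ) : Fin (d + 1) → ℤ))) : ℝ) : ℂ))
    ∧ (∫ ω, conj ((fun ω : (Fin (d + 1) → ℤ) → ℝ => Complex.exp (((ω 0 : ℝ) : ℂ) * I)) (configReflect (latticeTimeReflection (d + 1)) ω)) ∂kingFieldInf0 d
        = ((Real.exp (-(kingS2Inf0 (0 : Fin (d + 1) → ℤ) / 2)) : ℝ) : ℂ))
    ∧ (∫ ω, (fun ω : (Fin (d + 1) → ℤ) → ℝ => Complex.exp (((ω 0 : ℝ) : ℂ) * I)) ω ∂kingFieldInf0 d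
        = ((Real.exp (-(kingS2Inf0 (0 : Fin (d + 1) → ℤ) / 2)) : ℝ) : ℂ)) := by
  haveI := isProbabilityMeasure_kingFieldInf0 hd
  have hS := integral_conj_cexp_mul_cexp_siteMaps0 hd {0} (fun _ => (1 : ℝ)) (fun _ => (1 : ℝ)) (fun z => latticeTimeReflection (d + 1) z)
    (fun z => z + (Pi.single 0 (t : ℤ) : Fin (d + 1) → ℤ))
  have hA := integral_cexp_I_fieldSum0 hd ({0} : Finset (Fin (d + 1) → ℤ)) (fun z => latticeTimeReflection (d + 1) z) (fun _ => (1 : ℝ))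
  have hB := integral_cexp_I_fieldSum0 hd ({0} : Finset (Fin (d + 1) → ℤ)) id (fun _ => (1 : ℝ))
  simp only [Finset.sum_singleton, one_mul, sub_self, id, single_add_sub_latticeTimeReflection_zero] at hS hA hB
  refine ⟨?_, ?_, ?_⟩
  · simp only [configReflect_apply, latticeTimeShift_iterate_apply']
    exact hS
  · rw [integral_conj]
    simp only [configReflect_apply]
    rw [hA, ← Complex.exp_conj, map_neg, Complex.conj_ofReal, Complex.ofReal_exp]
    push_cast
    ring_nf
  · simp only
    rw [hB, Complex.ofReal_exp]
    push_cast
    ring_nf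

/-- ★★ **THE TRUNCATED OS PAIRING OF `e^{iφ(0)}` UNDER `μ⁰_∞`**: `= e^{−S₂^{0}(0)}(e^{S₂^{0}(e₀ + te₀)} − 1)`. [cite: King1986, Thm 2.1 (2.22) p.654; GlimmJaffe1987, §19.7] -/
theorem os_truncated_onePoint0_eq (hd : 2 ≤ d) (t : ℕ) :
    (∫ ω, conj ((fun ω : (Fin (d + 1) → ℤ) → ℝ => Complex.exp (((ω 0 : ℝ) : ℂ) * I)) (configReflect (latticeTimeReflection (d + 1)) ω))
        * (fun ω : (Fin (d + 1) → ℤ) → ℝ => Complex.exp (((ω 0 : ℝ) : ℂ) * I)) ((latticeTimeShift (d + 1) ℝ)^[t] ω) ∂kingFieldInf0 d)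
      - (∫ ω, conj ((fun ω : (Fin (d + 1) → ℤ) → ℝ => Complex.exp (((ω 0 : ℝ) : ℂ) * I)) (configReflect (latticeTimeReflection (d + 1)) ω)) ∂kingFieldInf0 d)
        * (∫ ω, (fun ω : (Fin (d + 1) → ℤ) → ℝ => Complex.exp (((ω 0 : ℝ) : ℂ) * I)) ω ∂kingFieldInf0 d)
      = ((Real.exp (-kingS2Inf0 (0 : Fin (d + 1) → ℤ)) * (Real.exp (kingS2Inf0 ((Pi.single 0 1 : Fin (d + 1) → ℤ) + (t : ℤ) • (Pi.single 0 (1 : ℤ) : Fin (d + 1) → ℤ))) - 1) : ℝ) : ℂ) := by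
  obtain ⟨h1, h2, h3⟩ := os_pairing_onePoint0_data hd t
  rw [h1, h2, h3]
  push_cast
  have hh : Complex.exp (-((kingS2Inf0 (0 : Fin (d + 1) → ℤ) : ℂ) / 2)) * Complex.exp (-((kingS2Inf0 (0 : Fin (d + 1) → ℤ) : ℂ) / 2))
      = Complex.exp (-(kingS2Inf0 (0 : Fin (d + 1) → ℤ) : ℂ)) := by
    rw [← Complex.exp_add]; ring_nf
  rw [hh]
  ring

/-- `e^{−S₂^{0}(0)}·S₂^{0}(e₀ + te₀) ≤ |truncated pairing|` (`e^x − 1 ≥ x`). [cite: King1986, Thm 2.1 (2.22) p.654] -/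
theorem os_truncated_onePoint0_norm_ge (d' : ℕ) (x : (Fin (d' + 1) → ℤ) → ℝ) (t : ℕ) :
    Real.exp (-x 0) * x ((Pi.single 0 1 : Fin (d' + 1) → ℤ) + (t : ℤ) • (Pi.single 0 (1 : ℤ) : Fin (d' + 1) → ℤ))
      ≤ ‖((Real.exp (-x 0) * (Real.exp (x ((Pi.single 0 1 : Fin (d' + 1) → ℤ) + (t : ℤ) • (Pi.single 0 (1 : ℤ) : Fin (d' + 1) → ℤ))) - 1) : ℝ) : ℂ)‖ := by
  rw [Complex.norm_real, Real.norm_eq_abs]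
  refine le_trans ?_ (le_abs_self _)
  refine mul_le_mul_of_nonneg_left ?_ (Real.exp_nonneg _)
  linarith [Real.add_one_le_exp (x ((Pi.single 0 1 : Fin (d' + 1) → ℤ) + (t : ℤ) • (Pi.single 0 (1 : ℤ) : Fin (d' + 1) → ℤ)))]

/-- `∫ ‖e^{iφ(0)}‖² dμ⁰_∞ = 1`. [folklore] -/
theorem integral_normSq_onePoint_cexp (hd : 2 ≤ d) :
    ∫ ω, ‖(fun ω : (Fin (d + 1) → ℤ) → ℝ => Complex.exp (((ω 0 : ℝ) : ℂ) * I)) ω‖ ^ 2 ∂kingFieldInf0 d = 1 := by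
  haveI := isProbabilityMeasure_kingFieldInf0 hd
  simp only [Complex.norm_exp_ofReal_mul_I, one_pow, integral_const, smul_eq_mul, mul_one]
  simp

/-! ## §3 The polynomial lower bound -/

/-- `‖e₀ + te₀‖₂ = t + 1`. [folklore] -/
theorem euclidNorm_single_add_smul (t : ℕ) :
    ‖WithLp.toLp 2 (fun μ => ((((Pi.single 0 1 : Fin (d + 1) → ℤ) + (t : ℤ) • (Pi.single 0 (1 : ℤ) : Fin (d + 1) → ℤ)) μ : ℤ) : ℝ))‖ = t + 1 := by
  rw [euclidNorm_eq]
  have hsum : ∑ μ : Fin (d + 1), ((((Pi.single 0 1 : Fin (d + 1) → ℤ) + (t : ℤ) • (Pi.single 0 (1 : ℤ) : Fin (d + 1) → ℤ)) μ : ℤ) : ℝ) ^ 2 = ((t : ℝ) + 1) ^ 2 := by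
    rw [Finset.sum_eq_single (0 : Fin (d + 1))]
    · simp; ring
    · intro μ _ hμ; simp [Pi.single_eq_of_ne hμ]
    · intro h0; exact absurd (Finset.mem_univ _) h0
  rw [hsum, Real.sqrt_sq (by positivity)]

/-- `R₊(e₀ + te₀) ≤ t + d + 2`. [folklore] -/
theorem blockSpan_axis_le (t : ℕ) :
    blockSpan ((Pi.single 0 1 : Fin (d + 1) → ℤ) + (t : ℤ) • (Pi.single 0 (1 : ℤ) : Fin (d + 1) → ℤ)) ≤ (t : ℝ) + d + 2 := by
  refine (blockSpan_le_norm_add _).trans ?_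
  rw [euclidNorm_single_add_smul]
  have hsq : Real.sqrt ((d : ℝ) + 1) ≤ (d : ℝ) + 1 := by
    rw [Real.sqrt_le_left (by positivity)]
    nlinarith [(Nat.cast_nonneg d : (0 : ℝ) ≤ d)]
  linarith

/-- ★★ **THE MASSLESS TWO-POINT FUNCTION ALONG THE TIME AXIS DECAYS AT MOST POLYNOMIALLY**: `S₂^{0}(e₀ + te₀) ≥ Γ((d−1)∕2)∕(4π^{(d+1)∕2}(t + d + 2)^{d−1})` (`d ≥ 2`).
[cite: King1986, Thm 2.1 (2.22) p.654, (4.5) p.670] -/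
theorem kingS2Inf0_axis_ge (hd : 2 ≤ d) (t : ℕ) :
    Real.Gamma (((d : ℝ) - 1) / 2) / (4 * Real.pi ^ (((d : ℝ) + 1) / 2) * ((t : ℝ) + d + 2) ^ (d - 1))
      ≤ kingS2Inf0 ((Pi.single 0 1 : Fin (d + 1) → ℤ) + (t : ℤ) • (Pi.single 0 (1 : ℤ) : Fin (d + 1) → ℤ)) := by
  refine le_trans ?_ (massless_le_kingS2Inf0 hd _)
  have hΓ : 0 < Real.Gamma (((d : ℝ) - 1) / 2) := Real.Gamma_pos_of_pos (by
    have : (2 : ℝ) ≤ d := by exact_mod_cast hd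
    linarith)
  have hsp := blockSpan_pos ((Pi.single 0 1 : Fin (d + 1) → ℤ) + (t : ℤ) • (Pi.single 0 (1 : ℤ) : Fin (d + 1) → ℤ))
  refine div_le_div_of_nonneg_left hΓ.le (by positivity) ?_
  exact mul_le_mul_of_nonneg_left (pow_le_pow_left₀ hsp.le (blockSpan_axis_le t) _) (by positivity)

/-- ★★★ **THE ONE-POINT LOWER BOUND BEATS EVERY GEOMETRIC SEQUENCE**: for `0 ≤ r < 1` there is `t` with `r^t < e^{−S₂^{0}(0)}·S₂^{0}(e₀ + te₀)` (polynomial decay versus `t^k r^t → 0`).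
[cite: King1986, Thm 2.1 (2.22) p.654; GlimmJaffe1987, §19.7] -/
theorem exists_pow_lt_onePoint0_lowerBound (hd : 2 ≤ d) {r : ℝ} (hr0 : 0 ≤ r) (hr1 : r < 1) :
    ∃ t : ℕ, r ^ t < Real.exp (-kingS2Inf0 (0 : Fin (d + 1) → ℤ)) * kingS2Inf0 ((Pi.single 0 1 : Fin (d + 1) → ℤ) + (t : ℤ) • (Pi.single 0 (1 : ℤ) : Fin (d + 1) → ℤ)) := by
  set c : ℝ := Real.exp (-kingS2Inf0 (0 : Fin (d + 1) → ℤ)) * (Real.Gamma (((d : ℝ) - 1) / 2) / (4 * Real.pi ^ (((d : ℝ) + 1) / 2))) with hc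
  have hΓ : 0 < Real.Gamma (((d : ℝ) - 1) / 2) := Real.Gamma_pos_of_pos (by
    have : (2 : ℝ) ≤ d := by exact_mod_cast hd
    linarith)
  have hc0 : 0 < c := by positivity
  have hlim : Tendsto (fun t : ℕ => ((d : ℝ) + 3) ^ (d - 1) * ((t : ℝ) ^ (d - 1) * r ^ t)) atTop (𝓝 0) := by
    have h := (tendsto_pow_const_mul_const_pow_of_lt_one (d - 1) hr0 hr1).const_mul (((d : ℝ) + 3) ^ (d - 1))
    rw [mul_zero] at h
    exact h
  obtain ⟨t, hlt, ht1⟩ := ((hlim.eventually (gt_mem_nhds hc0)).and (eventually_ge_atTop 1)).exists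
  refine ⟨t, ?_⟩
  have ht1' : (1 : ℝ) ≤ t := by exact_mod_cast ht1
  have hpoly : ((t : ℝ) + d + 2) ^ (d - 1) ≤ ((d : ℝ) + 3) ^ (d - 1) * (t : ℝ) ^ (d - 1) := by
    rw [← mul_pow]
    exact pow_le_pow_left₀ (by positivity) (by nlinarith [(Nat.cast_nonneg d : (0 : ℝ) ≤ d)]) _
  have hpos : 0 < ((t : ℝ) + d + 2) ^ (d - 1) := by positivity
  have hkey : r ^ t * ((t : ℝ) + d + 2) ^ (d - 1) < c := by
    calc r ^ t * ((t : ℝ) + d + 2) ^ (d - 1) ≤ r ^ t * (((d : ℝ) + 3) ^ (d - 1) * (t : ℝ) ^ (d - 1)) := mul_le_mul_of_nonneg_left hpoly (pow_nonneg hr0 t)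
      _ = ((d : ℝ) + 3) ^ (d - 1) * ((t : ℝ) ^ (d - 1) * r ^ t) := by ring
      _ < c := hlt
  have hlow := kingS2Inf0_axis_ge hd t
  calc r ^ t < c / ((t : ℝ) + d + 2) ^ (d - 1) := by rw [lt_div_iff₀ hpos]; exact hkey
    _ = Real.exp (-kingS2Inf0 (0 : Fin (d + 1) → ℤ)) * (Real.Gamma (((d : ℝ) - 1) / 2) / (4 * Real.pi ^ (((d : ℝ) + 1) / 2) * ((t : ℝ) + d + 2) ^ (d - 1))) := by
        rw [hc]; field_simp
    _ ≤ _ := mul_le_mul_of_nonneg_left hlow (Real.exp_nonneg _)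

end Summit.QuantumFields.YangMills.BalabanUVNodes.N15KingModelRung.InfiniteVolume
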